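import Summits.ResolutionOfSingularities.ResolutionOfSingularities.Theses.Valuative
import Literature.AlgebraicGeometry.Resolution.RegularDerivationQuotient

/-!
# `Valuative.LuAlphaPTorsor`, line `pfaff-line-log-final-forms`: the monogenic exit

Route `ResolutionOfSingularities/Valuative`, crux `LuAlphaPTorsor`
(stmt-ResolutionOfSingularities-0641), stub `stub_monogenicExit` of the lead's skeleton
`Cruxes/LuAlphaPTorsor/Lines/pfaff-line-log-final-forms.lean`, PROVED here
(`stub_monogenicExit`, statement verbatim from the ledger registration).

**Statement.** `A₁ ⊆ O` a finitely generated `k`-subalgebra of the valued field `(K, O)`,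
`char k = p`, regular at the centre `𝔭 = 𝔪_O ∩ A₁`, `t ∈ K` with `t ^ p ∈ A₁` and
`Frac (A₁[t]) = K`; in the regular local ring `R = (A₁)_𝔭` suppose `t ^ p - c ^ p = g ^ p · b` with
`g ≠ 0` and `δ b` a unit for some derivation `δ` of `R` (the "monogenic datum" of the final-form
trichotomy). Then some finitely generated `A ⊇ A₁` with `t ∈ A ⊆ O`, `Frac A = K` is regular at
the centre.

**Proof.** Embed `R ↪ K` (`a/s ↦ a s⁻¹`, `ν(s) = 1`) and put `t' := (t - c)/g`, so
`t'^p = (t^p - c^p)/g^p = b` (characteristic `p`) and `t' ∈ O` (`t'^p ∈ R ⊆ O`). The model is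
`A := A₁[t, t']`. For regularity at the centre:

* `B := R[x]/(x^p - b)` is a *regular ring*: Stacks 07PG
  (`isRegularRing_adjoinRoot_X_pow_sub_C_of_derivation`, tree `RegularDerivationQuotient.lean`)
  over the regular ring `R` (Serre's localisation theorem, Matsumura 19.3, tree
  `isRegularLocalRing_localization_atPrime`);
* `B` is *local* (Frobenius: `y ↦ y^p` maps `B` into `R`, and `y^p` or `(1 - y)^p = 1 - y^p` is a
  unit of the local ring `R`), hence a regular local ring, hence a domain; so the lift
  `ψ : B → K`, `x ↦ t'`, whose kernel lies over `0` in the integral extension `R ⊆ B`, is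
  injective, and `T := ψ(B) = R[t'] ⊆ O` is a regular ring isomorphic to `B`;
* `A ⊆ T ⊆ A_𝔮` inside `K` (`𝔮` the centre of `A`; elements of `R` are fractions `a/s` with
  `a, s ∈ A₁ ⊆ A`, `ν(s) = 1`), so `A` and `T` have the same local ring at the centre
  (Novacoski–Spivakovsky 2014 Lemma 2.5 (1), tree `centreLocalization_le`,
  `isRegularLocalRing_of_centreLocalization_eq`), and the local ring of `T` at its centre is a
  localisation of the regular ring `B` at a prime, hence regular.

Contents: §1 the ring `R[x]/(x^p - b)` (pure commutative algebra over Mathlib's `AdjoinRoot`);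
§2 glue on models inside `K` (five `private` one-liners adapted from
`Cruxes/LuAlphaPTorsor/Disproof.lean`, which is not importable from `Theorems/`; private because
the sibling stub file `ValuativeLuAlphaPTorsorBirationalExit.lean` declares the same names);
§3 the stub.
-/

/- Work log (stub-worker, 2026-08-16): Serre's theorem (Matsumura 19.3) IS proved in the tree
(`isRegularLocalRing_localization_atPrime`), so Stacks 07PG applies to `R = (A₁)_𝔭` directly: no
`κ^p` case split, no `RootAdjunctionRegular`, and the sub-case `t' ∈ Frac A₁` is not distinguished.
Only friction: the registered signature's `Derivation ℤ R R` carries `OreLocalization.instAlgebra`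
(not `Ring.toIntAlgebra`), so the lemmas of §1 take a derivation over an arbitrary base with
implicit `Algebra`/`Module` instances and convert it to a `ℤ`-derivation internally. -/

noncomputable section

-- `Summit.<S>.<S>.…` duplicates the summit name by design (D-0017, single-problem summit).
set_option linter.dupNamespace false

open Polynomial IsLocalRing

namespace Summit.ResolutionOfSingularities.ResolutionOfSingularities.Theorems.PfaffLine

open Literature.AlgebraicGeometry.Resolution

/-! ## §1 The ring `R[x]/(x^p - b)` -/

section MonogenicRing

variable {R : Type*} [CommRing R]

/-- A subring of `R[x]/(f)` containing the image of `R` and the class of `x` is everything. -/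
theorem adjoinRoot_mem_subring (f : R[X]) (S : Subring (AdjoinRoot f))
    (hof : ∀ r : R, AdjoinRoot.of f r ∈ S) (hroot : AdjoinRoot.root f ∈ S) (y : AdjoinRoot f) :
    y ∈ S := by
  let S' : Subalgebra R (AdjoinRoot f) := { S with algebraMap_mem' := hof }
  have h : Algebra.adjoin R ({AdjoinRoot.root f} : Set (AdjoinRoot f)) ≤ S' :=
    Algebra.adjoin_le (Set.singleton_subset_iff.mpr hroot)
  rw [AdjoinRoot.adjoinRoot_eq_top] at h
  exact h Algebra.mem_top

/-- In `R[x]/(x^p - b)` the class `z` of `x` satisfies `z^p = b`. -/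
theorem adjoinRoot_root_pow (p : ℕ) (b : R) :
    AdjoinRoot.root (X ^ p - C b : R[X]) ^ p = AdjoinRoot.of (X ^ p - C b : R[X]) b := by
  have := AdjoinRoot.eval₂_root (X ^ p - C b : R[X])
  rwa [eval₂_sub, eval₂_X_pow, eval₂_C, sub_eq_zero] at this

/-- `x^p - b` has non-zero degree (for `p` prime, `R` non-trivial). -/
theorem degree_X_pow_sub_C_ne_zero [Nontrivial R] {p : ℕ} (hp : p.Prime) (b : R) :
    (X ^ p - C b : R[X]).degree ≠ 0 := by
  rw [degree_X_pow_sub_C hp.pos]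
  exact_mod_cast hp.ne_zero

/-- **Frobenius trick**: over a domain `R` of prime characteristic `p`, every `p`-th power in
`B = R[x]/(x^p - b)` lies in the image of `R` (`(Σ rᵢ zⁱ)^p = Σ rᵢ^p bⁱ`). -/
theorem adjoinRoot_exists_of_eq_pow {p : ℕ} (hp : p.Prime) [CharP R p] [IsDomain R] (b : R)
    (y : AdjoinRoot (X ^ p - C b : R[X])) :
    ∃ r : R, AdjoinRoot.of (X ^ p - C b : R[X]) r = y ^ p := by
  haveI : CharP (AdjoinRoot (X ^ p - C b : R[X])) p :=
    charP_of_injective_ringHom (AdjoinRoot.of.injective_of_degree_ne_zero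
      (degree_X_pow_sub_C_ne_zero hp b)) p
  haveI : ExpChar (AdjoinRoot (X ^ p - C b : R[X])) p := ExpChar.prime hp
  let S : Subring (AdjoinRoot (X ^ p - C b : R[X])) :=
    (AdjoinRoot.of (X ^ p - C b : R[X])).range.comap (frobenius (AdjoinRoot (X ^ p - C b : R[X])) p)
  have hy : y ∈ S := by
    refine adjoinRoot_mem_subring _ S (fun r => ?_) ?_ y
    · change frobenius _ p (AdjoinRoot.of _ r) ∈ (AdjoinRoot.of (X ^ p - C b : R[X])).range
      rw [frobenius_def, ← map_pow]
      exact ⟨_, rfl⟩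
    · change frobenius _ p (AdjoinRoot.root _) ∈ (AdjoinRoot.of (X ^ p - C b : R[X])).range
      rw [frobenius_def, adjoinRoot_root_pow]
      exact ⟨b, rfl⟩
  obtain ⟨r, hr⟩ := Subring.mem_comap.mp hy
  exact ⟨r, by rw [hr, frobenius_def]⟩

/-- **`R[x]/(x^p - b)` is local** for a local domain `R` of prime characteristic `p`: for every
`y`, `y^p = r` and `(1 - y)^p = 1 - r` come from `R`, where `r` or `1 - r` is a unit. -/
theorem isLocalRing_adjoinRoot_X_pow_sub_C {p : ℕ} (hp : p.Prime) [CharP R p] [IsDomain R]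
    [IsLocalRing R] (b : R) : IsLocalRing (AdjoinRoot (X ^ p - C b : R[X])) := by
  set f : R[X] := X ^ p - C b with hf
  haveI := Fact.mk hp
  haveI : Nontrivial (AdjoinRoot f) := AdjoinRoot.nontrivial f (degree_X_pow_sub_C_ne_zero hp b)
  haveI : CharP (AdjoinRoot f) p :=
    charP_of_injective_ringHom (AdjoinRoot.of.injective_of_degree_ne_zero
      (degree_X_pow_sub_C_ne_zero hp b)) p
  refine IsLocalRing.of_isUnit_or_isUnit_one_sub_self fun y => ?_
  obtain ⟨r, hr⟩ := adjoinRoot_exists_of_eq_pow hp b y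
  have h1 : AdjoinRoot.of f (1 - r) = (1 - y) ^ p := by
    rw [map_sub, map_one, hr, sub_pow_char, one_pow]
  rcases IsLocalRing.isUnit_or_isUnit_one_sub_self r with hu | hu
  · exact Or.inl ((isUnit_pow_iff hp.ne_zero).mp (hr ▸ hu.map (AdjoinRoot.of f)))
  · exact Or.inr ((isUnit_pow_iff hp.ne_zero).mp (h1 ▸ hu.map (AdjoinRoot.of f)))

/-- **The monogenic exit ring is a regular ring** (all its localisations at primes are regular
local rings): for a regular local ring `R`, `b ∈ R` and a derivation `δ` of `R` (over any base)
with `δ b` a unit, `R[x]/(x^n - b)` is a regular ring — Stacks 07PG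
(`isRegularRing_adjoinRoot_X_pow_sub_C_of_derivation`) over the regular ring `R` (Serre's
localisation theorem, Matsumura 19.3, `isRegularLocalRing_localization_atPrime`), applied to
`δ` viewed as a `ℤ`-derivation. -/
theorem isRegularRing_adjoinRoot_of_derivation [IsRegularLocalRing R] {S₀ : Type*}
    [CommSemiring S₀] {_ : Algebra S₀ R} {_ : Module S₀ R} (n : ℕ) (b : R)
    (δ : Derivation S₀ R R) (hδ : IsUnit (δ b)) :
    IsRegularRing (AdjoinRoot (X ^ n - C b : R[X])) := by
  haveI : IsRegularRing R :=
    isRegularRing_iff.mpr fun q _ => isRegularLocalRing_localization_atPrime R q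
  let δℤ : Derivation ℤ R R := Derivation.mk' δ.toLinearMap.toAddMonoidHom.toIntLinearMap
    fun a c => by simp [Derivation.leibniz]
  have hδℤ : IsUnit (δℤ b) := hδ
  exact isRegularRing_adjoinRoot_X_pow_sub_C_of_derivation δℤ b hδℤ n

/-- **The monogenic exit ring is a regular local ring** in prime characteristic: for a regular
local ring `R` of prime characteristic `p`, `b ∈ R` and a derivation `δ` of `R` with `δ b` a
unit, `R[x]/(x^p - b)` is a regular local ring (a regular ring, and local). -/
theorem isRegularLocalRing_adjoinRoot_of_derivation {p : ℕ} (hp : p.Prime) [CharP R p]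
    [IsRegularLocalRing R] {S₀ : Type*} [CommSemiring S₀] {_ : Algebra S₀ R} {_ : Module S₀ R}
    (b : R) (δ : Derivation S₀ R R) (hδ : IsUnit (δ b)) :
    IsRegularLocalRing (AdjoinRoot (X ^ p - C b : R[X])) := by
  haveI := isDomain_of_isRegularLocalRing R
  haveI : IsRegularRing (AdjoinRoot (X ^ p - C b : R[X])) :=
    isRegularRing_adjoinRoot_of_derivation p b δ hδ
  haveI := isLocalRing_adjoinRoot_X_pow_sub_C hp b
  exact IsRegularLocalRing.of_isRegularRing_of_isLocalRing _

/-- **Lifts of the monogenic exit ring into domains are injective.** With `R`, `p`, `b`, `δ` as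
above, a ring map `R[x]/(x^p - b) → L` to a domain `L` whose restriction to `R` is injective is
injective: `R[x]/(x^p - b)` is a domain (regular local), integral over `R`, and its kernel is an
ideal lying over `0`. -/
theorem adjoinRoot_lift_injective {p : ℕ} (hp : p.Prime) [CharP R p] [IsRegularLocalRing R]
    {S₀ : Type*} [CommSemiring S₀] {_ : Algebra S₀ R} {_ : Module S₀ R} (b : R)
    (δ : Derivation S₀ R R) (hδ : IsUnit (δ b)) {L : Type*} [CommRing L] [IsDomain L]
    (i : R →+* L) (hi : Function.Injective i) (x : L)
    (hx : (X ^ p - C b : R[X]).eval₂ i x = 0) :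
    Function.Injective (AdjoinRoot.lift i x hx) := by
  set f : R[X] := X ^ p - C b with hf
  haveI := isRegularLocalRing_adjoinRoot_of_derivation hp b δ hδ
  haveI : IsDomain (AdjoinRoot f) := isDomain_of_isRegularLocalRing _
  haveI : Module.Finite R (AdjoinRoot f) := (monic_X_pow_sub_C b hp.ne_zero).finite_adjoinRoot
  haveI : Algebra.IsIntegral R (AdjoinRoot f) := inferInstance
  rw [RingHom.injective_iff_ker_eq_bot]
  apply Ideal.eq_bot_of_comap_eq_bot (R := R)
  rw [AdjoinRoot.algebraMap_eq, RingHom.comap_ker, AdjoinRoot.lift_comp_of,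
    ← RingHom.injective_iff_ker_eq_bot]
  exact hi

end MonogenicRing

/-! ## §2 Glue: models inside `K` -/

section Glue

variable {k K : Type} [Field k] [Field K] [Algebra k K]

-- adapted from Cruxes/LuAlphaPTorsor/Disproof.lean §Helpers
/-- Valuation rings are integrally closed, in the only form needed: `t ^ n ∈ O ⇒ t ∈ O`. -/
private theorem mem_of_pow_mem (O : ValuationSubring K) {t : K} {n : ℕ} (hn : n ≠ 0) (h : t ^ n ∈ O) :
    t ∈ O := by
  rw [← O.valuation_le_one_iff] at h ⊢
  rw [map_pow] at h
  by_contra hlt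
  exact (one_lt_pow₀ (lt_of_not_ge hlt) hn).not_ge h

-- adapted from Cruxes/LuAlphaPTorsor/Disproof.lean §Helpers
/-- `A₀[t] ⊆ O` as soon as `A₀ ⊆ O` and `t ∈ O`. -/
private theorem adjoin_insert_le (O : ValuationSubring K) (A₀ : Subalgebra k K)
    (h₀ : A₀.toSubring ≤ O.toSubring) {t : K} (ht : t ∈ O) :
    (Algebra.adjoin k (insert t (A₀ : Set K))).toSubring ≤ O.toSubring := by
  let Oalg : Subalgebra k K :=
    { O.toSubring with algebraMap_mem' := fun c => h₀ (A₀.algebraMap_mem c) }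
  change Algebra.adjoin k (insert t (A₀ : Set K)) ≤ Oalg
  refine Algebra.adjoin_le ?_
  rintro x (rfl | hx)
  · exact ht
  · exact h₀ hx

-- adapted from Cruxes/LuAlphaPTorsor/Disproof.lean §Helpers
/-- `A₀ ≤ A₀[t]`. -/
private theorem le_adjoin_insert_self (A₀ : Subalgebra k K) (t : K) :
    A₀ ≤ Algebra.adjoin k (insert t (A₀ : Set K)) :=
  fun _ hx => Algebra.subset_adjoin (Set.mem_insert_of_mem _ hx)

-- adapted from Cruxes/LuAlphaPTorsor/Disproof.lean §Helpers
/-- `t ∈ A₀[t]`. -/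
private theorem self_mem_adjoin_insert (A₀ : Subalgebra k K) (t : K) :
    t ∈ Algebra.adjoin k (insert t (A₀ : Set K)) :=
  Algebra.subset_adjoin (Set.mem_insert _ _)

-- adapted from Cruxes/LuAlphaPTorsor/Disproof.lean §Helpers
/-- `A₀[t]` is finitely generated when `A₀` is. -/
private theorem adjoin_insert_fg {A₀ : Subalgebra k K} (hfg : A₀.FG) (t : K) :
    (Algebra.adjoin k (insert t (A₀ : Set K))).FG := by
  classical
  obtain ⟨s, rfl⟩ := hfg
  rw [Algebra.adjoin_insert_adjoin, ← Finset.coe_insert]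
  exact Subalgebra.fg_adjoin_finset _

/-- Transport of regularity of the localisation at the centre along a ring isomorphism onto a
model: if `e : B ≃ C ⊆ O` and the localisation of `B` at the pull-back of the centre is regular,
so is the localisation of `C` at the centre. -/
theorem isRegularLocalRing_centre_of_ringEquiv (O : ValuationSubring K) {B : Type*} [CommRing B]
    (C : Subalgebra k K) (hC : C.toSubring ≤ O.toSubring) (e : B ≃+* C.toSubring)
    (hreg : IsRegularLocalRing (Localization.AtPrime
      (((maximalIdeal O).comap (Subring.inclusion hC)).comap e.toRingHom))) :
    IsRegularLocalRing (Localization.AtPrime ((maximalIdeal O).comap (Subring.inclusion hC))) := by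
  set P : Ideal C.toSubring := (maximalIdeal O).comap (Subring.inclusion hC)
  have hmap : Submonoid.map e.toRingHom.toMonoidHom (P.comap e.toRingHom).primeCompl =
      P.primeCompl := by
    ext y
    constructor
    · rintro ⟨x, hx, rfl⟩
      simpa [Ideal.primeCompl] using hx
    · intro hy
      refine ⟨e.symm y, ?_, by simp⟩
      simpa [Ideal.primeCompl] using hy
  exact IsRegularLocalRing.of_ringEquiv (R := Localization.AtPrime (P.comap e.toRingHom))
    (IsLocalization.ringEquivOfRingEquiv (Localization.AtPrime (P.comap e.toRingHom))
      (Localization.AtPrime P) e hmap)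

end Glue

/-! ## §3 The stub -/

/-- **Stub `stub_monogenicExit` of the line `pfaff-line-log-final-forms`** (crux
`Valuative.LuAlphaPTorsor`, stmt-0641): the monogenic exit. Let `A₁ ⊆ O` be a finitely generated
model, regular at the centre, with `t ^ p ∈ A₁` and `Frac (A₁[t]) = K`, and suppose that in the
local ring `R = (A₁)_𝔭` of the centre `t ^ p - c ^ p = g ^ p · b` with `g ≠ 0` and `δ b` a unit for
some derivation `δ` of `R`. Put `t' := (t - c) / g ∈ K`, so `t'^p = b` and `t' ∈ O`. Then
`A := A₁[t, t'] ⊆ O` is a finitely generated model containing `t`, and it is regular at the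
centre: `A ⊆ R[t'] ⊆ A_𝔮` inside `K` (so `A` and `R[t']` have the same local ring at the centre,
Novacoski–Spivakovsky Lemma 2.5 (1)), and `R[t'] ≅ R[x]/(x^p - b)` (the lift `x ↦ t'` is
injective) is a regular ring by Stacks 07PG, so its localisation at the centre is regular. -/
theorem stub_monogenicExit :
    ∀ p : ℕ, p.Prime → ∀ (k K : Type) [Field k] [CharP k p] [Field K] [Algebra k K] (O : ValuationSubring K) (A₁ : Subalgebra k K) (h₁ : A₁.toSubring ≤ O.toSubring) (t : K), A₁.FG → ∀ (htp : t ^ p ∈ A₁), IsFractionRing (Algebra.adjoin k (insert t (A₁ : Set K))) K → IsRegularLocalRing (Localization.AtPrime (Ideal.comap (Subring.inclusion h₁) (IsLocalRing.maximalIdeal O))) → (∃ (c g b : Localization.AtPrime (Ideal.comap (Subring.inclusion h₁) (IsLocalRing.maximalIdeal O))) (δ : Derivation ℤ (Localization.AtPrime (Ideal.comap (Subring.inclusion h₁) (IsLocalRing.maximalIdeal O))) (Localization.AtPrime (Ideal.comap (Subring.inclusion h₁) (IsLocalRing.maximalIdeal O)))), g ≠ 0 ∧ algebraMap A₁.toSubring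 (Localization.AtPrime (Ideal.comap (Subring.inclusion h₁) (IsLocalRing.maximalIdeal O))) ⟨t ^ p, htp⟩ - c ^ p = g ^ p * b ∧ IsUnit (δ b)) → ∃ (A : Subalgebra k K) (h : A.toSubring ≤ O.toSubring), A₁ ≤ A ∧ t ∈ A ∧ A.FG ∧ IsFractionRing A K ∧ IsRegularLocalRing (Localization.AtPrime (Ideal.comap (Subring.inclusion h) (IsLocalRing.maximalIdeal O))) := by
  intro p hp k K _ _ _ _ O A₁ h₁ t hfg htp hfr hreg hdat
  obtain ⟨c, g, b, δ, hg0, hrel, hδ⟩ := hdat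
  classical
  haveI := Fact.mk hp
  haveI := hreg
  -- the centre `𝔭` of `O` on `A₁` and the embedding `φ : R = (A₁)_𝔭 → K`
  set 𝔭 : Ideal A₁.toSubring := (maximalIdeal O).comap (Subring.inclusion h₁)
  have hunit : ∀ s : 𝔭.primeCompl, IsUnit (algebraMap A₁.toSubring K s) := fun s => by
    rw [isUnit_iff_ne_zero]
    intro h0
    apply s.2
    have : (s : A₁.toSubring) = 0 := Subtype.ext h0
    rw [this]
    exact 𝔭.zero_mem
  set φ : Localization.AtPrime 𝔭 →+* K := IsLocalization.lift hunit
  have hφa : ∀ a : A₁.toSubring, φ (algebraMap _ _ a) = a := fun a => IsLocalization.lift_eq hunit a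
  have hφinj : Function.Injective φ := by
    refine (IsLocalization.lift_injective_iff hunit).mpr fun x y => ⟨fun h => ?_, fun h => ?_⟩
    · rw [IsLocalization.injective (Localization.AtPrime 𝔭) 𝔭.primeCompl_le_nonZeroDivisors h]
    · rw [show x = y from Subtype.ext h]
  have hφ : ∀ r : Localization.AtPrime 𝔭, ∃ a ∈ A₁, ∃ s ∈ A₁, O.valuation s = 1 ∧ φ r = a * s⁻¹ := by
    intro r
    obtain ⟨⟨a, s⟩, rfl⟩ := IsLocalization.mk'_surjective 𝔭.primeCompl r
    have hs1 : O.valuation (s : K) = 1 := (mem_primeCompl_centre_iff O A₁ h₁ s).mp s.2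
    have hs0 : ((s : A₁.toSubring) : K) ≠ 0 := by
      intro h0
      rw [h0, map_zero] at hs1
      exact zero_ne_one hs1
    refine ⟨a, a.2, s, s.1.2, hs1, ?_⟩
    apply (IsLocalization.lift_mk'_spec hunit a _ s).mpr
    change (a : K) = (s : K) * ((a : K) * ((s : A₁.toSubring) : K)⁻¹)
    field_simp
  have hφO : ∀ r, φ r ∈ O := fun r => by
    obtain ⟨a, ha, s, hs, hs1, hr⟩ := hφ r
    rw [hr]
    exact O.toSubring.mul_mem (h₁ ha) (inv_mem_of_valuation_eq_one O hs1)
  haveI : CharP K p := charP_of_injective_algebraMap (algebraMap k K).injective p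
  haveI : CharP (Localization.AtPrime 𝔭) p := φ.charP hφinj p
  -- the new element `t' = (t - c) / g`, `t' ^ p = b`
  have hrelK : t ^ p - φ c ^ p = φ g ^ p * φ b := by
    have := congrArg φ hrel
    rw [map_sub, map_mul, map_pow, map_pow, hφa] at this
    exact this
  have hg0K : φ g ≠ 0 := (map_ne_zero_iff φ hφinj).mpr hg0
  set t' : K := (t - φ c) / φ g with ht'
  have ht'p : t' ^ p = φ b := by
    rw [ht', div_pow, sub_pow_char, hrelK]
    field_simp
  have ht_eq : t = φ c + φ g * t' := by
    rw [ht']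
    field_simp
    ring
  have ht'O : t' ∈ O := mem_of_pow_mem O hp.ne_zero (by rw [ht'p]; exact hφO b)
  have htO : t ∈ O := mem_of_pow_mem O hp.ne_zero (h₁ htp)
  -- the model `A = A₁[t, t']`
  set At : Subalgebra k K := Algebra.adjoin k (insert t (A₁ : Set K))
  set A : Subalgebra k K := Algebra.adjoin k (insert t' (At : Set K))
  have hAtO : At.toSubring ≤ O.toSubring := adjoin_insert_le O A₁ h₁ htO
  have hAO : A.toSubring ≤ O.toSubring := adjoin_insert_le O At hAtO ht'O
  have hA₁A : A₁ ≤ A := (le_adjoin_insert_self A₁ t).trans (le_adjoin_insert_self At t')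
  have htA : t ∈ A := le_adjoin_insert_self At t' (self_mem_adjoin_insert A₁ t)
  have ht'A : t' ∈ A := self_mem_adjoin_insert At t'
  have hAfr : IsFractionRing A K :=
    @isFractionRing_subalgebra_of_le k K _ _ _ At A (le_adjoin_insert_self At t') hfr
  refine ⟨A, hAO, hA₁A, htA, adjoin_insert_fg (adjoin_insert_fg hfg t) t', hAfr, ?_⟩
  -- the abstract ring `B = R[x]/(x^p - b)` and its embedding `ψ : B → K`, `x ↦ t'`
  have hev : (X ^ p - C b : (Localization.AtPrime 𝔭)[X]).eval₂ φ t' = 0 := by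
    rw [eval₂_sub, eval₂_X_pow, eval₂_C, ht'p, sub_self]
  set ψ : AdjoinRoot (X ^ p - C b : (Localization.AtPrime 𝔭)[X]) →+* K :=
    AdjoinRoot.lift φ t' hev
  have hψof : ∀ r, ψ (AdjoinRoot.of _ r) = φ r := fun r => AdjoinRoot.lift_of hev
  have hψroot : ψ (AdjoinRoot.root _) = t' := AdjoinRoot.lift_root hev
  have hψinj : Function.Injective ψ := adjoinRoot_lift_injective hp b δ hδ φ hφinj t' hev
  haveI : IsRegularRing (AdjoinRoot (X ^ p - C b : (Localization.AtPrime 𝔭)[X])) :=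
    isRegularRing_adjoinRoot_of_derivation p b δ hδ
  -- its image `T = R[t'] ⊆ O`, a model containing `A`
  let T : Subalgebra k K :=
    { ψ.range with
      algebraMap_mem' := fun x => ⟨AdjoinRoot.of _ (algebraMap A₁.toSubring _
        ⟨algebraMap k K x, A₁.algebraMap_mem x⟩), by rw [hψof, hφa]⟩ }
  have hmemT : ∀ {S : Subring K}, (∀ r, φ r ∈ S) → t' ∈ S → (T : Set K) ⊆ S := by
    intro S hS ht'S
    rintro _ ⟨x, rfl⟩
    refine adjoinRoot_mem_subring _ (S.comap ψ) (fun r => ?_) ?_ x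
    · rw [Subring.mem_comap, hψof]
      exact hS r
    · rw [Subring.mem_comap, hψroot]
      exact ht'S
  have hTO : T.toSubring ≤ O.toSubring := fun x hx => hmemT (S := O.toSubring) hφO ht'O hx
  have hA₁T : (A₁ : Set K) ⊆ T := fun a ha =>
    ⟨AdjoinRoot.of _ (algebraMap A₁.toSubring _ ⟨a, ha⟩), by rw [hψof, hφa]⟩
  have htT : t ∈ T := by
    rw [ht_eq]
    exact T.add_mem ⟨_, hψof c⟩ (T.mul_mem ⟨_, hψof g⟩ ⟨_, hψroot⟩)
  have hAtT : At ≤ T := Algebra.adjoin_le (Set.insert_subset htT hA₁T)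
  have hAT : A ≤ T := Algebra.adjoin_le (Set.insert_subset ⟨_, hψroot⟩ hAtT)
  haveI : IsFractionRing A.toSubring K := hAfr
  haveI : IsFractionRing T.toSubring K := @isFractionRing_subalgebra_of_le k K _ _ _ A T hAT hAfr
  -- `A ⊆ T ⊆ A_𝔮` inside `K`: the two models have the same local ring at the centre
  have hTΛ : (T : Set K) ⊆ Localization.subalgebra.ofField K
      ((maximalIdeal O).comap (Subring.inclusion hAO)).primeCompl
      (Ideal.primeCompl_le_nonZeroDivisors _) := by
    refine hmemT (S := (Localization.subalgebra.ofField K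
      ((maximalIdeal O).comap (Subring.inclusion hAO)).primeCompl
      (Ideal.primeCompl_le_nonZeroDivisors _)).toSubring) (fun r => ?_)
      (le_centreLocalization O A hAO ht'A)
    rw [Subalgebra.mem_toSubring, mem_centreLocalization_iff]
    obtain ⟨a, ha, s, hs, hs1, hr⟩ := hφ r
    exact ⟨a, hA₁A ha, s, hA₁A hs, hs1, hr⟩
  have heq : ((Localization.subalgebra.ofField K
      ((maximalIdeal O).comap (Subring.inclusion hAO)).primeCompl
      (Ideal.primeCompl_le_nonZeroDivisors _)) : Set K) =
      Localization.subalgebra.ofField K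
      ((maximalIdeal O).comap (Subring.inclusion hTO)).primeCompl
      (Ideal.primeCompl_le_nonZeroDivisors _) :=
    le_antisymm (centreLocalization_le O A T hAO hTO
        ((show (A : Set K) ⊆ T from hAT).trans (le_centreLocalization O T hTO)))
      (centreLocalization_le O T A hTO hAO hTΛ)
  refine isRegularLocalRing_of_centreLocalization_eq O A T hAO hTO heq ?_
  -- `T ≅ B` is a regular ring, so its localisation at the centre is regular
  let ψ' : AdjoinRoot (X ^ p - C b : (Localization.AtPrime 𝔭)[X]) →+* T.toSubring :=
    ψ.codRestrict T.toSubring fun x => ⟨x, rfl⟩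
  have hψ'bij : Function.Bijective ψ' :=
    ⟨fun x y hxy => hψinj (congrArg Subtype.val hxy), fun ⟨y, x, hx⟩ => ⟨x, Subtype.ext hx⟩⟩
  exact isRegularLocalRing_centre_of_ringEquiv O T hTO (RingEquiv.ofBijective ψ' hψ'bij)
    inferInstance

end Summit.ResolutionOfSingularities.ResolutionOfSingularities.Theorems.PfaffLine

end
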